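import Mathlib
import Summits.Ventures.PercRepro2.Defs
import Summits.Ventures.PercRepro2.CoinDefs
import Summits.Ventures.PercRepro2.CoinTreeCore

/-!
# Out-tree cores: ancestors of a reached vertex are reached (blind cell PercRepro2, night-2 g9;
proofs/NIGHT2-DARC.md §36)

In an out-tree core (`TreeCore`) a reached vertex's parent is reached (`TreeCore.reach_par`: its
only entering arc is the tree arc from the parent), hence every ancestor `par^[j] v` with the
intermediate vertices in the core (`TreeCore.reach_iterate_par`).  This is the cut-vertex
property behind the far-marker forms of row 2′DARC (`darc_of_orTailTrees3`,
`darc_of_orTailTreeDom`, …).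
-/

namespace Summit.Ventures.PercRepro2.Coin

open Classical

section TreeAncestor

variable {V : Type*} {E : Type*} [DecidableEq V]
  {arcs : E → Finset (V × V)} {s : V} {C : Finset V} {c : V → E} {par : V → V} {rk : V → ℕ}

omit [DecidableEq V] in
/-- In an out-tree core, a reached vertex's parent is reached (its only entering arc is the tree
arc from the parent). -/
lemma TreeCore.reach_par (h : TreeCore arcs s C c par rk) {ω : Config E} {v : V} (hv : v ∈ C)
    (hr : Reach arcs ω s v) : Reach arcs ω s (par v) := by
  rcases Relation.ReflTransGen.cases_tail hr with hsv | ⟨x, hsx, hxv⟩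
  · exact absurd (hsv ▸ hv) h.s_notin
  · obtain ⟨e, _, hxv'⟩ := hxv
    obtain ⟨v', hv', rfl⟩ := h.into_C e (x, v) hxv' hv
    rw [h.tree v' hv', Finset.mem_singleton, Prod.mk.injEq] at hxv'
    obtain ⟨rfl, rfl⟩ := hxv'
    exact hsx

omit [DecidableEq V] in
/-- In an out-tree core, every ancestor of a reached vertex is reached. -/
lemma TreeCore.reach_iterate_par (h : TreeCore arcs s C c par rk) {ω : Config E} {v : V}
    (hr : Reach arcs ω s v) (j : ℕ) (hj : ∀ i < j, par^[i] v ∈ C) :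
    Reach arcs ω s (par^[j] v) := by
  induction j with
  | zero => simpa using hr
  | succ n ih =>
    rw [Function.iterate_succ_apply']
    exact h.reach_par (hj n (Nat.lt_succ_self n)) (ih fun i hi => hj i (Nat.lt_succ_of_lt hi))

end TreeAncestor

end Summit.Ventures.PercRepro2.Coin
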